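import Summits.HodgeConjecture.CorCM.Census.MultiFieldWeilSetTransitive
import Summits.HodgeConjecture.CorCM.SexticOcticWeilJointTransitive
import Mathlib.Data.Fintype.BigOperators
import Mathlib.Data.Nat.GCD.BigOperators
import HarnessLib

/-!
# MULTI-FIELD WEIL ENGINE — JOINT SET-TRANSITIVITY IS AUTOMATIC FOR ORBITS OF PAIRWISE COPRIME SIZES (any number of slots): the `r`-fold form of gen 26ʼs
# counting lemma `SexticOcticWeil.exists_mem_pair_of_coprime`

Cell `pub-hodgecm2` (COR-CM), seat b30 gen 29 (2026-08-24); count-neutral own lane MULTI-FIELD WEIL ENGINE (stem `MultiFieldWeil*`), sequel of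
`Census/MultiFieldWeilSetTransitive.lean`.  Finite combinatorics of the model only (no field, no geometry); theorems only (the bookkeeping notions `preG`, `orbitG` live in census part 4); no named fact,
no `sorry`, no `decide`.

THE ARGUMENT.  `R ⊆ ∏_m Sym(n_m)` closed under products and inverses, non-empty; `𝒳_m := {π_m⁻¹(P_m) | π ∈ R}` the orbit of the position set of slot `m`.
CLAIM (**`jointSetTransitiveG_orbitG_of_coprime`**): if the sizes `|𝒳_m|` are PAIRWISE COPRIME, `R` is jointly set-transitive onto `(P_m)_m` over `∏_m 𝒳_m`
(`Census.MultiFieldWeil.JointSetTransitiveG`) — hence (census part 4) every `R`-balanced configuration obeys the defect law as soon as each `𝒳_m` separates.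
PROOF by induction on a set `S` of slots (**`exists_forall_mem_of_coprime`**): `R` acts on the finite set `X_S = ∏_{m ∈ S} 𝒳_m` (transitively, by induction) and
on `𝒳_{m₀}` (transitively, an orbit) through pairs of permutations closed under products and inverses; `|X_S| = ∏_{m∈S} |𝒳_m|` is coprime to `|𝒳_{m₀}|`, so
gen 26ʼs two-factor counting lemma (orbit fibres of one size, `|X|·f = |Y|·g`) gives joint transitivity on `X_S × 𝒳_{m₀} = X_{S ∪ {m₀}}`.
[cite: DixonMortimer1996, §1.6 and §2.1]

## References
* [DixonMortimer1996] J. D. Dixon, B. Mortimer, *Permutation Groups*, GTM 163, §1.6, §2.1.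
-/

namespace Summit.HodgeConjecture.CorCM.MultiFieldWeil

open Finset
open Summit.HodgeConjecture.CorCM.Census.MultiFieldWeil
open Summit.HodgeConjecture.CorCM.SexticOcticWeil (exists_mem_pair_of_coprime)

open scoped Classical

variable {r : ℕ} {n : Fin r → ℕ} {R : Finset (PermsG n)} {P : ∀ m : Fin r, Finset (Fin (n m))}

/-! ## §2 Joint set-transitivity on the orbits from pairwise coprime orbit sizes -/

section Coprime

/-- The action of `π ∈ R` on the tuples `X_S = ∏_{m ∈ S} 𝒳_m` (as dependent functions on `S`) stays in `X_S`. [folklore] -/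
theorem act_mem_pi (hmul : ∀ π ∈ R, ∀ π' ∈ R, π * π' ∈ R) {S : Finset (Fin r)} {π : PermsG n} (hπ : π ∈ R) {f : ∀ m ∈ S, Finset (Fin (n m))}
    (hf : f ∈ S.pi fun m => orbitG R P m) : (fun m hm => preG (π m) (f m hm)) ∈ S.pi fun m => orbitG R P m := by
  rw [Finset.mem_pi] at hf ⊢
  exact fun m hm => preG_mem_orbitG hmul hπ (hf m hm)

/-- **THE INDUCTION.**  For every set `S` of slots whose orbit sizes are pairwise coprime: every tuple `f ∈ ∏_{m ∈ S} 𝒳_m` is the tuple of preimages of `(P m)_{m ∈ S}`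
under ONE member of `R`. [cite: DixonMortimer1996, §1.6 and §2.1] -/
theorem exists_forall_mem_of_coprime (hmul : ∀ π ∈ R, ∀ π' ∈ R, π * π' ∈ R) (hinv : ∀ π ∈ R, π⁻¹ ∈ R) (hne : R.Nonempty)
    (hcop : ∀ m m' : Fin r, m ≠ m' → ((orbitG R P m).card).Coprime ((orbitG R P m').card)) (S : Finset (Fin r)) :
    ∀ f : ∀ m ∈ S, Finset (Fin (n m)), (f ∈ S.pi fun m => orbitG R P m) → ∃ π ∈ R, ∀ (m : Fin r) (hm : m ∈ S) (a : Fin (n m)), π m a ∈ P m ↔ a ∈ f m hm := by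
  induction S using Finset.induction_on with
  | empty =>
    intro f _
    obtain ⟨π, hπ⟩ := hne
    exact ⟨π, hπ, fun m hm => absurd hm (Finset.notMem_empty m)⟩
  | @insert m₀ S hm₀ ih =>
    intro g hg
    -- the two finite sets acted on: `X = ∏_{m ∈ S} 𝒳_m` and `Y = 𝒳_{m₀}`
    let X : Type := ↥(S.pi fun m => orbitG R P m)
    let Y : Type := ↥(orbitG R P m₀)
    -- the permutations of `X` and `Y` induced by `π ∈ R`
    have hXmap : ∀ π ∈ R, ∃ σ : Equiv.Perm X, ∀ x : X, ((σ x) : ∀ m ∈ S, Finset (Fin (n m))) = fun m hm => preG (π m) (x.1 m hm) := by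
      intro π hπ
      let F : X → X := fun x => ⟨fun m hm => preG (π m) (x.1 m hm), act_mem_pi hmul hπ x.2⟩
      have hF : Function.Injective F := by
        intro x x' h
        apply Subtype.ext
        funext m hm
        have h' := congrArg (fun y : X => y.1 m hm) h
        exact preG_injective (π m) h'
      exact ⟨Equiv.ofBijective F (Finite.injective_iff_bijective.1 hF), fun x => rfl⟩
    have hYmap : ∀ π ∈ R, ∃ σ : Equiv.Perm Y, ∀ y : Y, ((σ y) : Finset (Fin (n m₀))) = preG (π m₀) y.1 := by
      intro π hπ
      let F : Y → Y := fun y => ⟨preG (π m₀) y.1, preG_mem_orbitG hmul hπ y.2⟩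
      have hF : Function.Injective F := fun y y' h => Subtype.ext (preG_injective (π m₀) (congrArg Subtype.val h))
      exact ⟨Equiv.ofBijective F (Finite.injective_iff_bijective.1 hF), fun y => rfl⟩
    -- the realised pairs
    let R' : Set (Equiv.Perm X × Equiv.Perm Y) := {p | ∃ π ∈ R,
      (∀ x : X, ((p.1 x) : ∀ m ∈ S, Finset (Fin (n m))) = fun m hm => preG (π m) (x.1 m hm)) ∧
        ∀ y : Y, ((p.2 y) : Finset (Fin (n m₀))) = preG (π m₀) y.1}
    have hmemR' : ∀ π ∈ R, ∃ p ∈ R', (∀ x : X, ((p.1 x) : ∀ m ∈ S, Finset (Fin (n m))) = fun m hm => preG (π m) (x.1 m hm)) ∧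
        ∀ y : Y, ((p.2 y) : Finset (Fin (n m₀))) = preG (π m₀) y.1 := by
      intro π hπ
      obtain ⟨σ, hσ⟩ := hXmap π hπ
      obtain ⟨σ', hσ'⟩ := hYmap π hπ
      exact ⟨(σ, σ'), ⟨π, hπ, hσ, hσ'⟩, hσ, hσ'⟩
    have hmul' : ∀ p ∈ R', ∀ p' ∈ R', p * p' ∈ R' := by
      rintro p ⟨π, hπ, h₁, h₂⟩ p' ⟨π', hπ', h₁', h₂'⟩
      refine ⟨π' * π, hmul π' hπ' π hπ, fun x => ?_, fun y => ?_⟩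
      · change ((p.1 (p'.1 x)) : ∀ m ∈ S, Finset (Fin (n m))) = _
        rw [h₁]
        funext m hm
        rw [h₁' x, Pi.mul_apply, preG_mul]
      · change ((p.2 (p'.2 y)) : Finset (Fin (n m₀))) = _
        rw [h₂, h₂' y, Pi.mul_apply, preG_mul]
    have hinv' : ∀ p ∈ R', p⁻¹ ∈ R' := by
      rintro p ⟨π, hπ, h₁, h₂⟩
      refine ⟨π⁻¹, hinv π hπ, fun x => ?_, fun y => ?_⟩
      · have h := h₁ (p.1⁻¹ x)
        rw [Equiv.Perm.inv_def, Equiv.apply_symm_apply] at h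
        rw [Prod.fst_inv, Equiv.Perm.inv_def]
        funext m hm
        conv_rhs => rw [h]
        simp only [Pi.inv_apply, preG_inv_preG]
      · have h := h₂ (p.2⁻¹ y)
        rw [Equiv.Perm.inv_def, Equiv.apply_symm_apply] at h
        rw [Prod.snd_inv, Equiv.Perm.inv_def]
        conv_rhs => rw [h]
        rw [Pi.inv_apply, preG_inv_preG]
    -- `1 ∈ R`, the base points
    have h1 : (1 : PermsG n) ∈ R := one_mem_of_closed hmul hinv hne
    -- transitivity on `X` (induction hypothesis) and on `Y` (an orbit)
    have hbaseX : ∀ x : X, ∃ π ∈ R, (x : ∀ m ∈ S, Finset (Fin (n m))) = fun m hm => preG (π m) (P m) := by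
      intro x
      obtain ⟨π, hπ, hπx⟩ := ih x.1 x.2
      refine ⟨π, hπ, ?_⟩
      funext m hm
      ext a
      rw [mem_preG]
      exact ((hπx m hm a)).symm
    have hXt : ∀ x x' : X, ∃ p ∈ R', p.1 x = x' := by
      intro x x'
      obtain ⟨π₁, hπ₁, hx⟩ := hbaseX x
      obtain ⟨π₂, hπ₂, hx'⟩ := hbaseX x'
      obtain ⟨p, hp, hp₁, -⟩ := hmemR' (π₁⁻¹ * π₂) (hmul _ (hinv π₁ hπ₁) π₂ hπ₂)
      refine ⟨p, hp, Subtype.ext ?_⟩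
      rw [hp₁ x, hx', hx]
      funext m hm
      rw [Pi.mul_apply, preG_mul, Pi.inv_apply, preG_inv_preG]
    have hYt : ∀ y y' : Y, ∃ p ∈ R', p.2 y = y' := by
      intro y y'
      obtain ⟨π₁, hπ₁, hy⟩ := mem_orbitG.1 y.2
      obtain ⟨π₂, hπ₂, hy'⟩ := mem_orbitG.1 y'.2
      obtain ⟨p, hp, -, hp₂⟩ := hmemR' (π₁⁻¹ * π₂) (hmul _ (hinv π₁ hπ₁) π₂ hπ₂)
      refine ⟨p, hp, Subtype.ext ?_⟩
      rw [hp₂ y, ← hy', ← hy, Pi.mul_apply, preG_mul, Pi.inv_apply, preG_inv_preG]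
    -- the sizes
    have hcardX : Fintype.card X = ∏ m ∈ S, (orbitG R P m).card := by
      rw [Fintype.card_coe, Finset.card_pi]
    have hcardY : Fintype.card Y = (orbitG R P m₀).card := Fintype.card_coe _
    have hXY : (Fintype.card X).Coprime (Fintype.card Y) := by
      rw [hcardX, hcardY]
      exact Nat.Coprime.prod_left fun m hm => hcop m m₀ (fun h => hm₀ (h ▸ hm))
    -- the base points and the targets
    have hgS : (fun m (hm : m ∈ S) => g m (Finset.mem_insert_of_mem hm)) ∈ S.pi fun m => orbitG R P m := by
      rw [Finset.mem_pi] at hg ⊢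
      exact fun m hm => hg m (Finset.mem_insert_of_mem hm)
    have hg₀ : g m₀ (Finset.mem_insert_self m₀ S) ∈ orbitG R P m₀ := (Finset.mem_pi.1 hg) m₀ (Finset.mem_insert_self m₀ S)
    have hbS : (fun m (_ : m ∈ S) => P m) ∈ S.pi fun m => orbitG R P m := Finset.mem_pi.2 fun m _ => self_mem_orbitG h1 m
    let x₀ : X := ⟨fun m _ => P m, hbS⟩
    let x : X := ⟨fun m hm => g m (Finset.mem_insert_of_mem hm), hgS⟩
    let y₀ : Y := ⟨P m₀, self_mem_orbitG h1 m₀⟩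
    let y : Y := ⟨g m₀ (Finset.mem_insert_self m₀ S), hg₀⟩
    -- the counting lemma: ONE pair moves `(x₀, y₀)` to `(x, y)`
    obtain ⟨p, ⟨π, hπ, hp₁, hp₂⟩, hpx, hpy⟩ := exists_mem_pair_of_coprime hXY R' hmul' hinv' hXt hYt x x₀ y y₀
    refine ⟨π, hπ, fun m hm a => ?_⟩
    rcases Finset.mem_insert.1 hm with rfl | hmS
    · have h := hp₂ y₀
      rw [hpy] at h
      have h' : g _ hm = preG (π _) (P _) := h
      rw [h', mem_preG]
    · have h := hp₁ x₀
      rw [hpx] at h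
      have h' : g m hm = preG (π m) (P m) := congrFun (congrFun h m) hmS
      rw [h', mem_preG]

/-- **JOINT SET-TRANSITIVITY FROM PAIRWISE COPRIME ORBIT SIZES.**  `R ⊆ ∏_m Sym(n_m)` product-closed, inverse-closed, non-empty, the orbits `𝒳_m` of the position
sets of pairwise coprime sizes ⟹ `R` is jointly set-transitive onto `(P m)_m` over `∏_m 𝒳_m` — the hypothesis `hjt` of
`Census.MultiFieldWeil.exists_hasDefectsG_of_jointSetTransitiveG`. [cite: DixonMortimer1996, §1.6 and §2.1] -/
theorem jointSetTransitiveG_orbitG_of_coprime (hmul : ∀ π ∈ R, ∀ π' ∈ R, π * π' ∈ R) (hinv : ∀ π ∈ R, π⁻¹ ∈ R) (hne : R.Nonempty)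
    (hcop : ∀ m m' : Fin r, m ≠ m' → ((orbitG R P m).card).Coprime ((orbitG R P m').card)) :
    JointSetTransitiveG R P (orbitG R P) := by
  intro Q hQ
  have hf : (fun m (_ : m ∈ (univ : Finset (Fin r))) => Q m) ∈ (univ : Finset (Fin r)).pi fun m => orbitG R P m :=
    Finset.mem_pi.2 fun m _ => hQ m
  obtain ⟨π, hπ, h⟩ := exists_forall_mem_of_coprime hmul hinv hne hcop univ _ hf
  exact ⟨π, hπ, fun m a => h m (Finset.mem_univ m) a⟩

end Coprime

/-! ## §3 The defect law for orbits of pairwise coprime sizes -/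

section Defect

variable {α : Type*} {v : α → PtG n}

/-- **THE DEFECT LAW for any number of slots whose position-set orbits have PAIRWISE COPRIME sizes and SEPARATE** (e.g. one-member types over fields of pairwise
coprime relative degrees, `Census.MultiFieldWeil.sep_of_singletons`; `p`-homogeneous slots, `sep_of_powersetCard`): every `R`-balanced configuration obeys the
defect law with `c_m = n_m − 2|P m|` — the hypothesis `hdef` of the generic headline. [cite: DixonMortimer1996, §2.1] [cite: MoonenZarhin1995Duke, Thm. 2.4] -/
theorem exists_hasDefectsG_of_coprime_orbits (hmul : ∀ π ∈ R, ∀ π' ∈ R, π * π' ∈ R) (hinv : ∀ π ∈ R, π⁻¹ ∈ R) (hne : R.Nonempty)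
    (hcop : ∀ m m' : Fin r, m ≠ m' → ((orbitG R P m).card).Coprime ((orbitG R P m').card))
    (hsep : ∀ (m : Fin r) (f : Fin (n m) → ℤ), (∀ Q ∈ orbitG R P m, ∑ a ∈ Q, f a = ∑ a ∈ P m, f a) → ∀ a b : Fin (n m), f a = f b)
    (hc : ∀ m, 2 * (P m).card ≤ n m) {T : Finset α} (hT : ModelBalancedG P R v T) :
    ∃ t : Fin r → ℤ, HasDefectsG (fun m => n m - 2 * (P m).card) v T t :=
  exists_hasDefectsG_of_jointSetTransitiveG (fun m => self_mem_orbitG (one_mem_of_closed hmul hinv hne) m)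
    (jointSetTransitiveG_orbitG_of_coprime hmul hinv hne hcop) hne hsep hc hT

end Defect

end Summit.HodgeConjecture.CorCM.MultiFieldWeil
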